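import Mathlib
import HarnessLib
import Literature.AlgebraicGeometry.HyperbolicPolynomials.SpectrahedralShadow
import Summits.ValiantsHypothesis.ValiantsHypothesis.Theorems.PermanentalConesHyperbolicVPShadowStubSpectrahedronOfSymmDetIdentity

/-!
# ValiantsHypothesis / PermanentalCones — `HyperbolicVPShadow`, stub O₁

Route `PermanentalCones`, item `stmt-ValiantsHypothesis-8655` (crux `HyperbolicVPShadow`), line
`birth`, stub `stub_oshimeFamily1_spectrahedron` (Oshime's family (1) of non-symmetrisable
real-spectrum `3 × 3` pencils has size-`3` spectrahedral cones).

Oshime (J. Math. Kyoto Univ. 31 (1991), Thm 4.7) lists, among the uniformly real-diagonalisable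
`3 × 3` families that are not simultaneously symmetrisable, family (1)
`⟨A, B, C_a⟩ = ⟨diag (1, 0, 0), E₁₂ + E₂₁, !![0, a, 1; -a, 0, 0; 1, 0, 0]⟩` (`0 < a < 1`).
For every real `a` with `a² ≤ 1` the pencil `P x = x₀ A + x₁ B + x₂ C_a` satisfies the
*real symmetric* determinantal identity

  `det (P x + τ·1) = τ³ + x₀ τ² − x₁² τ − (1 − a²) x₂² τ = det (L x + τ·1)`,
  `L x = !![0, 0, x₁; 0, 0, c x₂; x₁, c x₂, x₀]`, `c = √(1 − a²)`

(a polynomial identity in `x₀, x₁, x₂, τ` modulo `c² = 1 − a²`, checked by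
`linear_combination`). Feeding it to `stub_spectrahedron_of_symmDetIdentity` shows that the
closed nonnegative-spectrum cone `{x : ∀ τ > 0, det (P x + τ·1) ≠ 0}` is the spectrahedron
`{x : L x ⪰ 0}` of size `3`.

No definitions are introduced: the matrices are written out as literals, the two pencils are
`Fintype.linearCombination ℝ ![…]`.
-/

-- `<Problem> = <Summit>` for this single-conjunct summit (lakefile sets the same option tree-wide).
set_option linter.dupNamespace false

namespace Summit.ValiantsHypothesis.ValiantsHypothesis.Theorems

open Matrix

/-! ## The two pencils -/

/-- The family-(1) pencil as a linear map: `Fintype.linearCombination ℝ ![A, B, C_a] x =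
x₀ A + x₁ B + x₂ C_a`. [folklore] -/
theorem permanentalCones_oshime1_P_apply (a : ℝ) (x : Fin 3 → ℝ) :
    Fintype.linearCombination ℝ ![(!![(1 : ℝ), 0, 0; 0, 0, 0; 0, 0, 0] : Matrix (Fin 3) (Fin 3) ℝ),
        !![(0 : ℝ), 1, 0; 1, 0, 0; 0, 0, 0], !![(0 : ℝ), a, 1; -a, 0, 0; 1, 0, 0]] x =
      x 0 • !![(1 : ℝ), 0, 0; 0, 0, 0; 0, 0, 0] + x 1 • !![(0 : ℝ), 1, 0; 1, 0, 0; 0, 0, 0] +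
        x 2 • !![(0 : ℝ), a, 1; -a, 0, 0; 1, 0, 0] := by
  rw [Fintype.linearCombination_apply, Fin.sum_univ_three]
  rfl

/-- Entries of `P x + τ·1 = !![τ + x₀, x₁ + a x₂, x₂; x₁ − a x₂, τ, 0; x₂, 0, τ]`. [folklore] -/
theorem permanentalCones_oshime1_P_entries (a : ℝ) (x : Fin 3 → ℝ) (τ : ℝ) :
    x 0 • !![(1 : ℝ), 0, 0; 0, 0, 0; 0, 0, 0] + x 1 • !![(0 : ℝ), 1, 0; 1, 0, 0; 0, 0, 0] +
        x 2 • !![(0 : ℝ), a, 1; -a, 0, 0; 1, 0, 0] + τ • (1 : Matrix (Fin 3) (Fin 3) ℝ) =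
      !![τ + x 0, x 1 + a * x 2, x 2; x 1 - a * x 2, τ, 0; x 2, 0, τ] := by
  ext i j
  fin_cases i <;> fin_cases j <;> simp <;> ring

/-- The symmetric certificate pencil as a linear map:
`Fintype.linearCombination ℝ ![E₃₃, E₁₃ + E₃₁, c (E₂₃ + E₃₂)] x =
!![0, 0, x₁; 0, 0, c x₂; x₁, c x₂, x₀]`. [folklore] -/
theorem permanentalCones_oshime1_L_apply (c : ℝ) (x : Fin 3 → ℝ) :
    Fintype.linearCombination ℝ ![(!![0, 0, 0; 0, 0, 0; 0, 0, 1] : Matrix (Fin 3) (Fin 3) ℝ),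
        !![0, 0, 1; 0, 0, 0; 1, 0, 0], !![0, 0, 0; 0, 0, c; 0, c, 0]] x =
      !![0, 0, x 1; 0, 0, c * x 2; x 1, c * x 2, x 0] := by
  ext i j
  rw [Fintype.linearCombination_apply, Fin.sum_univ_three]
  fin_cases i <;> fin_cases j <;> simp <;> ring

/-- Every `L x = !![0, 0, x₁; 0, 0, c x₂; x₁, c x₂, x₀]` is symmetric. [folklore] -/
theorem permanentalCones_oshime1_L_isSymm (c : ℝ) (x : Fin 3 → ℝ) :
    (!![0, 0, x 1; 0, 0, c * x 2; x 1, c * x 2, x 0] : Matrix (Fin 3) (Fin 3) ℝ).IsSymm :=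
  Matrix.IsSymm.ext fun i j => by fin_cases i <;> fin_cases j <;> simp

/-! ## The symmetric determinantal certificate -/

/-- The certificate: if `c² = 1 − a²` then
`det !![τ + x₀, x₁ + a x₂, x₂; x₁ − a x₂, τ, 0; x₂, 0, τ] = det (L x + τ·1)`
(both sides equal `τ³ + x₀ τ² − x₁² τ − (1 − a²) x₂² τ`). [folklore] -/
theorem permanentalCones_oshime1_det_eq (a c : ℝ) (hc : c ^ 2 = 1 - a ^ 2) (x : Fin 3 → ℝ)
    (τ : ℝ) :
    (!![τ + x 0, x 1 + a * x 2, x 2; x 1 - a * x 2, τ, 0; x 2, 0, τ] :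
        Matrix (Fin 3) (Fin 3) ℝ).det =
      ((!![0, 0, x 1; 0, 0, c * x 2; x 1, c * x 2, x 0] : Matrix (Fin 3) (Fin 3) ℝ) +
        τ • (1 : Matrix (Fin 3) (Fin 3) ℝ)).det := by
  simp only [Fin.isValue, det_fin_three, Matrix.add_apply, of_apply, cons_val', cons_val_zero,
    cons_val_fin_one, Matrix.smul_apply, one_apply_eq, smul_eq_mul, mul_one, zero_add, cons_val_one,
    cons_val, ne_eq, Fin.reduceEq, not_false_eq_true, one_apply_ne, mul_zero, add_zero, zero_ne_one,
    one_ne_zero]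
  linear_combination (τ * x 2 ^ 2) * hc

/-! ## The stub -/

/-- **Stub O₁ (Oshime's family (1) has size-`3` spectrahedral cones).** For every real `a` with
`a² ≤ 1`, the closed nonnegative-spectrum cone `{x : ∀ τ > 0, det (x₀ A + x₁ B + x₂ C_a + τ·1) ≠ 0}`
of the pencil `⟨A, B, C_a⟩ = ⟨diag (1, 0, 0), E₁₂ + E₂₁, !![0, a, 1; -a, 0, 0; 1, 0, 0]⟩`
(Oshime 1991, Thm 4.7, family (1)) is a spectrahedron of size `3`: by the real symmetric
certificate `L x = x₀ E₃₃ + x₁ (E₁₃ + E₃₁) + √(1 − a²) x₂ (E₂₃ + E₃₂)`,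
`det (P x + τ·1) = det (L x + τ·1)`, and `stub_spectrahedron_of_symmDetIdentity`. [folklore] -/
theorem stub_oshimeFamily1_spectrahedron :
    ∀ a : ℝ, a ^ 2 ≤ 1 →
      Literature.AlgebraicGeometry.HyperbolicPolynomials.IsSpectrahedralShadowOfSize
        {x : Fin 3 → ℝ | ∀ τ : ℝ, 0 < τ →
          (x 0 • !![(1 : ℝ), 0, 0; 0, 0, 0; 0, 0, 0] + x 1 • !![(0 : ℝ), 1, 0; 1, 0, 0; 0, 0, 0] +
            x 2 • !![(0 : ℝ), a, 1; -a, 0, 0; 1, 0, 0] + τ • (1 : Matrix (Fin 3) (Fin 3) ℝ)).det ≠ 0} 3 := by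
  intro a ha
  -- the real constant `c = √(1 − a²)` of the certificate, with `c² = 1 − a²`
  obtain ⟨c, hc⟩ : ∃ c : ℝ, c ^ 2 = 1 - a ^ 2 := ⟨Real.sqrt (1 - a ^ 2), Real.sq_sqrt (by linarith)⟩
  -- the determinantal identity `det (P x + τ·1) = det (L x + τ·1)`
  have hdet : ∀ (x : Fin 3 → ℝ) (τ : ℝ),
      (Fintype.linearCombination ℝ
          ![(!![(1 : ℝ), 0, 0; 0, 0, 0; 0, 0, 0] : Matrix (Fin 3) (Fin 3) ℝ),
            !![(0 : ℝ), 1, 0; 1, 0, 0; 0, 0, 0], !![(0 : ℝ), a, 1; -a, 0, 0; 1, 0, 0]] x +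
          τ • (1 : Matrix (Fin 3) (Fin 3) ℝ)).det =
        (Fintype.linearCombination ℝ ![(!![0, 0, 0; 0, 0, 0; 0, 0, 1] : Matrix (Fin 3) (Fin 3) ℝ),
          !![0, 0, 1; 0, 0, 0; 1, 0, 0], !![0, 0, 0; 0, 0, c; 0, c, 0]] x +
          τ • (1 : Matrix (Fin 3) (Fin 3) ℝ)).det := fun x τ => by
    rw [permanentalCones_oshime1_P_apply, permanentalCones_oshime1_P_entries,
      permanentalCones_oshime1_L_apply]
    exact permanentalCones_oshime1_det_eq a c hc x τ
  -- stub S turns the identity into a size-`3` spectrahedral description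
  have h := stub_spectrahedron_of_symmDetIdentity 3 3 _ _
    (fun x => (permanentalCones_oshime1_L_apply c x).symm ▸ permanentalCones_oshime1_L_isSymm c x)
    hdet
  simpa only [permanentalCones_oshime1_P_apply] using h

end Summit.ValiantsHypothesis.ValiantsHypothesis.Theorems
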